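import Summits.ValiantsHypothesis.ValiantsHypothesis.Theorems.LacunarySymmetroidMatrixDescartesPivotTwoDirectionsBlockLaw
import Literature.Algebra.Polynomial.DescartesSignVariations

/-!
# `MatrixDescartes` census — THE KILL ENGINE WITH MULTIPLICITY AND THE PARITY BRIDGE
# (`pos(P) ≤ pos(X·P′ − ρ·P) + 1` counted WITH multiplicity; odd chambers: every «≤ 2k» by kills is «≤ 2k − 1»)

HONEST FRAMING.  Object-search cell `pub-symmetroid`, seat `val-sym-mdr-p1` (generation 26); helper file `--supports` the crux item
stmt-ValiantsHypothesis-18050 (`Theses.LacunarySymmetroid.MatrixDescartes`, OPEN, on HOLD) with NO closure claim.  An INSTRUMENT for the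
rank-one `(2,4)₁` row (chamber (C) of the `1|3` split, where Descartes-with-parity allows `9` and the tree's kill theorems
`…PivotRankOneOneThreeKillEight{,Pairs}` / `…KillSeven*` give `≤ 8` distinct roots under circuit / weight-free conditions).  Nothing here bears
on `MatrixDescartes` in its window, on `DoorA26` / `DoorA34`, registers / credences, or `VP ≠ VNP`.

THE POINT.  The tree's weighted Rolle inequality `…TwoDirections.BlockLaw.card_posRoots_le_kill` counts DISTINCT positive roots.  Counted WITH
MULTIPLICITY the same inequality holds (§1 `countP_posRoots_le_kill`: a root of multiplicity `μ` of `P` is a root of multiplicity `≥ μ − 1`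
of `X·P′ − ρ·P`, and Rolle for `P(x)/x^ρ` puts a further root strictly between consecutive distinct positive roots — the proof of Mathlib's
`Polynomial.card_roots_le_derivative` with the kill operator in place of the derivative and `(0,∞)` in place of `ℝ`), hence so does the
iterated form (§1 `countP_posRoots_le_kills`), and the terminal lemma of the circuit method is already stated with multiplicity
(`Census.countP_posRoots_trinomial_eq_zero_of_circuit`).  WITH multiplicity, Descartes' PARITY applies: the number of positive roots of a
real polynomial whose trailing coefficient is negative and whose leading coefficient is positive is ODD (§2 `odd_countP_posRoots`, from
`Literature…Descartes.even_countP_roots_pos_iff`), so in such a chamber a kill bound `≤ 2k` with multiplicity is `≤ 2k − 1`, and the number of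
DISTINCT positive roots is at most that (§2 `card_posRoots_le_countP`, `card_posRoots_le_pred_of_odd`).  For the all-core rank-one `1|3`
split (`det F = ∑_{k<l} wₖwₗ(tₖ−tₗ)² x^{dₖ+dₗ} − 2∑ₖ wₖtₖ x^{e+dₖ} − x^{2e}`: trailing term `−2w₀t₀x^{e+d₀}`, leading term
`w₂w₃(t₂−t₃)²x^{d₂+d₃}`) this turns every multiplicity-aware «`≤ 8`» in chamber (C) into «`≤ 7`» = the value of the kernel SEVEN object
(`…CriticalWindowsOneSidedSevenExact`); the companion file `…PivotRankOneOneThreeKillEightOdd` does this for the four circuit conditions.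

[folklore] Rolle / mean value theorem (Mathlib `exists_deriv_eq_zero`, `Finset.card_le_sdiff_of_interleaved`), root multiplicities
(`Polynomial.le_rootMultiplicity_iff`, `pow_sub_one_dvd_derivative_of_pow_dvd`, `Multiset.toFinset_sum_count_eq`), Descartes' parity
[cite: BasuPollackRoy2006, Thm. 2.33] through the tree's `Literature.Algebra.Polynomial.Descartes.even_countP_roots_pos_iff`.
No definitions, no named facts.
-/

-- `Summit.ValiantsHypothesis.ValiantsHypothesis.…` repeats a component by the D-0017 layout
-- (single-conjunct summit), which the `dupNamespace` linter flags; the name is mandated.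
set_option linter.dupNamespace false

namespace Summit.ValiantsHypothesis.ValiantsHypothesis.Theorems.LacunarySymmetroidMatrixDescartes.Pivot.KillMult

open Polynomial Finset
open scoped BigOperators
open Summit.ValiantsHypothesis.ValiantsHypothesis.Theorems.LacunarySymmetroidMatrixDescartes.Pivot.TwoDirections.BlockLaw (kill_sum)

/-! ## 1. Weighted Rolle with multiplicity -/

/-- The kill operator on coefficients: `coeff n (X·P′ − ρ·P) = (n − ρ)·coeff n P`. [folklore] -/
theorem coeff_kill (ρ : ℕ) (P : ℝ[X]) (n : ℕ) :
    ((X : ℝ[X]) * derivative P - Polynomial.C (ρ : ℝ) * P).coeff n = ((n : ℝ) - ρ) * P.coeff n := by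
  rw [coeff_sub, coeff_C_mul]
  rcases Nat.eq_zero_or_pos n with h0 | hpos
  · subst h0
    simp
  · obtain ⟨m, rfl⟩ : ∃ m, n = m + 1 := ⟨n - 1, by omega⟩
    rw [coeff_X_mul, coeff_derivative]
    push_cast
    ring

/-- If the kill of `P` vanishes identically then `P` is a monomial `c·X^ρ`, so it has no positive root. [folklore] -/
theorem countP_posRoots_eq_zero_of_kill_eq_zero (ρ : ℕ) (P : ℝ[X])
    (hK : (X : ℝ[X]) * derivative P - Polynomial.C (ρ : ℝ) * P = 0) :
    P.roots.countP (fun x => 0 < x) = 0 := by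
  classical
  have hcoef : ∀ n, n ≠ ρ → P.coeff n = 0 := by
    intro n hn
    have h := congrArg (fun Q => Q.coeff n) hK
    simp only [coeff_kill, coeff_zero] at h
    rcases mul_eq_zero.1 h with h | h
    · exact absurd (by exact_mod_cast (sub_eq_zero.1 h) : n = ρ) hn
    · exact h
  have hP : P = Polynomial.C (P.coeff ρ) * X ^ ρ := by
    ext n
    rw [coeff_C_mul_X_pow]
    split_ifs with h
    · rw [h]
    · exact hcoef n h
  rw [Multiset.countP_eq_zero]
  intro x hx
  rw [hP] at hx
  by_cases hc : P.coeff ρ = 0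
  · rw [hc, map_zero, zero_mul, roots_zero] at hx
    simp at hx
  · rw [roots_C_mul_X_pow hc, Multiset.mem_nsmul] at hx
    rw [Multiset.mem_singleton.1 hx.2]
    exact lt_irrefl 0

/-- For a finite set `F` of points all satisfying `p`, the counts of a multiset over `F` add up to at most the number of its elements
satisfying `p`. [folklore] -/
theorem sum_count_le_countP {α : Type*} [DecidableEq α] (M : Multiset α) (p : α → Prop) [DecidablePred p] (F : Finset α)
    (hF : ∀ x ∈ F, p x) : ∑ x ∈ F, M.count x ≤ M.countP p := by
  rw [Multiset.countP_eq_card_filter, ← Multiset.toFinset_sum_count_eq]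
  have h1 : ∑ x ∈ F, M.count x = ∑ x ∈ F, (M.filter p).count x :=
    Finset.sum_congr rfl fun x hx => (Multiset.count_filter_of_pos (hF x hx)).symm
  rw [h1]
  calc ∑ x ∈ F, (M.filter p).count x
      = ∑ x ∈ F ∩ (M.filter p).toFinset, (M.filter p).count x := by
        rw [← Finset.sum_subset (Finset.inter_subset_left (s₁ := F) (s₂ := (M.filter p).toFinset))]
        intro x hxF hxn
        rw [Finset.mem_inter, not_and, Multiset.mem_toFinset] at hxn
        exact Multiset.count_eq_zero.2 (hxn hxF)
    _ ≤ ∑ x ∈ (M.filter p).toFinset, (M.filter p).count x :=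
        Finset.sum_le_sum_of_subset (Finset.inter_subset_right)

/-- **WEIGHTED ROLLE WITH MULTIPLICITY.**  The number of positive roots of a real polynomial `P` COUNTED WITH MULTIPLICITY is at most one more
than that of `X·P′ − ρ·P`, for every `ρ : ℕ`.  (A positive root of multiplicity `μ` of `P` is a root of multiplicity `≥ μ − 1` of the kill,
and Rolle for `P(x)/x^ρ` on `(0,∞)` gives one more root of the kill strictly between consecutive distinct positive roots.) [folklore] -/
theorem countP_posRoots_le_kill (ρ : ℕ) (P : ℝ[X]) :
    P.roots.countP (fun x => 0 < x)
      ≤ ((X : ℝ[X]) * derivative P - Polynomial.C (ρ : ℝ) * P).roots.countP (fun x => 0 < x) + 1 := by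
  classical
  set K : ℝ[X] := (X : ℝ[X]) * derivative P - Polynomial.C (ρ : ℝ) * P with hKdef
  by_cases hP : P = 0
  · subst hP; simp
  by_cases hK : K = 0
  · rw [countP_posRoots_eq_zero_of_kill_eq_zero ρ P hK]; exact Nat.zero_le _
  -- (a) multiplicities: (X − x)^{μ−1} divides the kill
  have hmult : ∀ x : ℝ, P.rootMultiplicity x - 1 ≤ K.rootMultiplicity x := by
    intro x
    rw [le_rootMultiplicity_iff hK]
    have hdvd : (X - Polynomial.C x) ^ P.rootMultiplicity x ∣ P := pow_rootMultiplicity_dvd P x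
    have h1 : (X - Polynomial.C x) ^ (P.rootMultiplicity x - 1) ∣ derivative P := pow_sub_one_dvd_derivative_of_pow_dvd hdvd
    have h2 : (X - Polynomial.C x) ^ (P.rootMultiplicity x - 1) ∣ P :=
      (pow_dvd_pow _ (Nat.sub_le _ _)).trans hdvd
    exact dvd_sub (dvd_mul_of_dvd_right h1 _) (dvd_mul_of_dvd_right h2 _)
  -- (b) Rolle between consecutive distinct positive roots (the tree's argument for `P(x)/x^ρ`)
  set S := P.roots.toFinset.filter (fun t => 0 < t) with hS
  set N := K.roots.toFinset.filter (fun t => 0 < t) with hN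
  set g : ℝ → ℝ := fun t => P.eval t / t ^ ρ with hg
  have hK_eval : ∀ x, K.eval x = x * (derivative P).eval x - ρ * P.eval x := by
    intro x; simp [hKdef]
  have hderiv : ∀ z, 0 < z → HasDerivAt g (K.eval z / z ^ (ρ + 1)) z := by
    intro z hz0
    have hzne : z ^ ρ ≠ 0 := pow_ne_zero _ hz0.ne'
    have hd := (P.hasDerivAt z).div (hasDerivAt_pow ρ z) hzne
    have e : ((derivative P).eval z * z ^ ρ - P.eval z * ((ρ : ℝ) * z ^ (ρ - 1))) / (z ^ ρ) ^ 2
        = K.eval z / z ^ (ρ + 1) := by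
      rw [hK_eval, div_eq_div_iff (pow_ne_zero 2 hzne) (pow_ne_zero _ hz0.ne')]
      rcases Nat.eq_zero_or_pos ρ with h0 | hpos
      · subst h0; ring
      · have e1 : z ^ ρ = z * z ^ (ρ - 1) := by rw [← pow_succ', Nat.sub_add_cancel hpos]
        rw [pow_succ, e1]; ring
    rw [e] at hd
    exact hd
  have hgcont : ∀ x y, 0 < x → ContinuousOn g (Set.Icc x y) := by
    intro x y hx0
    refine ContinuousOn.div P.continuousOn (continuousOn_pow ρ) fun t ht => ?_
    exact pow_ne_zero _ (ne_of_gt (lt_of_lt_of_le hx0 ht.1))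
  have hinter : S.card ≤ (N \ S).card + 1 := by
    refine Finset.card_le_sdiff_of_interleaved fun x hx y hy hxy _ => ?_
    rw [hS, Finset.mem_filter, Multiset.mem_toFinset, mem_roots hP] at hx hy
    obtain ⟨hxr, hx0⟩ := hx
    obtain ⟨hyr, hy0⟩ := hy
    have hgxy : g x = g y := by
      simp only [hg]; rw [show P.eval x = 0 from hxr, show P.eval y = 0 from hyr, zero_div, zero_div]
    obtain ⟨z, hz, hz'⟩ := exists_deriv_eq_zero hxy (hgcont x y hx0) hgxy
    have hz0 : 0 < z := hx0.trans hz.1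
    have hval := (hderiv z hz0).deriv
    rw [hz'] at hval
    have hKz : K.eval z = 0 := by
      have h := hval.symm
      rw [div_eq_zero_iff] at h
      rcases h with h | h
      · exact h
      · exact absurd h (pow_ne_zero _ hz0.ne')
    refine ⟨z, ?_, hz.1, hz.2⟩
    rw [hN, Finset.mem_filter, Multiset.mem_toFinset, mem_roots hK]
    exact ⟨hKz, hz0⟩
  -- (c) the count, as in Mathlib's `card_roots_le_derivative`
  have hSpos : ∀ x ∈ S, 0 < x := fun x hx => (Finset.mem_filter.1 hx).2
  have hSroot : ∀ x ∈ S, x ∈ P.roots := fun x hx => Multiset.mem_toFinset.1 (Finset.mem_filter.1 hx).1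
  have hcountP : P.roots.countP (fun x => 0 < x) = ∑ x ∈ S, P.roots.count x := by
    rw [Multiset.countP_eq_card_filter, ← Multiset.toFinset_sum_count_eq, hS, ← Multiset.toFinset_filter]
    refine Finset.sum_congr rfl fun x hx => ?_
    rw [Multiset.toFinset_filter] at hx
    exact Multiset.count_filter_of_pos (Finset.mem_filter.1 hx).2
  have hstep : ∑ x ∈ S, P.roots.count x = (∑ x ∈ S, (P.rootMultiplicity x - 1)) + S.card := by
    rw [Finset.card_eq_sum_ones, ← Finset.sum_add_distrib]
    refine Finset.sum_congr rfl fun x hx => ?_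
    rw [count_roots]
    have : 1 ≤ P.rootMultiplicity x := by
      rw [← count_roots]; exact Nat.succ_le_iff.2 (Multiset.count_pos.2 (hSroot x hx))
    omega
  have hNpos : ∀ x ∈ S ∪ (N \ S), 0 < x := by
    intro x hx
    rcases Finset.mem_union.1 hx with hx | hx
    · exact hSpos x hx
    · exact (Finset.mem_filter.1 (Finset.mem_sdiff.1 hx).1).2
  calc P.roots.countP (fun x => 0 < x)
      = (∑ x ∈ S, (P.rootMultiplicity x - 1)) + S.card := by rw [hcountP, hstep]
    _ ≤ (∑ x ∈ S, K.rootMultiplicity x) + ((N \ S).card + 1) :=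
        add_le_add (Finset.sum_le_sum fun x _ => hmult x) hinter
    _ ≤ (∑ x ∈ S, K.roots.count x) + ((∑ x ∈ N \ S, K.roots.count x) + 1) := by
        simp only [← count_roots, Finset.card_eq_sum_ones]
        gcongr with x hx
        rw [Nat.succ_le_iff, Multiset.count_pos, ← Multiset.mem_toFinset]
        exact (Finset.mem_filter.1 (Finset.mem_sdiff.1 hx).1).1
    _ = (∑ x ∈ S ∪ (N \ S), K.roots.count x) + 1 := by
        rw [← add_assoc, ← Finset.sum_union Finset.disjoint_sdiff]
    _ ≤ K.roots.countP (fun x => 0 < x) + 1 := by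
        have := sum_count_le_countP K.roots (fun x : ℝ => 0 < x) (S ∪ (N \ S)) hNpos
        omega

/-- **ITERATED WEIGHTED ROLLE WITH MULTIPLICITY on a fewnomial.**  Killing the degrees of a list `L` one after the other multiplies the
coefficient of `X^{nᵢ}` by `∏_{ρ ∈ L} (nᵢ − ρ)` and costs at most one positive root — counted with multiplicity — per step
(the `countP` twin of `…BlockLaw.card_posRoots_le_kills`). [folklore] -/
theorem countP_posRoots_le_kills {ι : Type*} (s : Finset ι) (n : ι → ℕ) (L : List ℕ) (c : ι → ℝ) :
    (∑ i ∈ s, Polynomial.C (c i) * X ^ n i).roots.countP (fun x => 0 < x)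
      ≤ (∑ i ∈ s, Polynomial.C (c i * (L.map (fun ρ : ℕ => ((n i : ℝ) - (ρ : ℝ)))).prod) * X ^ n i).roots.countP
          (fun x => 0 < x) + L.length := by
  induction L generalizing c with
  | nil => simp
  | cons ρ L ih =>
    have h1 := countP_posRoots_le_kill ρ (∑ i ∈ s, Polynomial.C (c i) * X ^ n i)
    rw [kill_sum] at h1
    have h2 := ih (fun i => c i * ((n i : ℝ) - ρ))
    simp only [List.map_cons, List.prod_cons, List.length_cons, ← mul_assoc] at h2 ⊢
    omega

/-! ## 2. The parity bridge -/

/-- Distinct positive roots are at most the positive roots counted with multiplicity. [folklore] -/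
theorem card_posRoots_le_countP (P : ℝ[X]) :
    (P.roots.toFinset.filter (fun t => 0 < t)).card ≤ P.roots.countP (fun x => 0 < x) := by
  classical
  rw [← Multiset.toFinset_filter, Multiset.countP_eq_card_filter]
  exact Multiset.toFinset_card_le _

/-- **ODD NUMBER OF POSITIVE ROOTS.**  If `P = X^k · Q` with `Q(0) < 0` (negative trailing coefficient) and positive leading coefficient, then the
number of positive roots of `P`, counted with multiplicity, is ODD. [cite: BasuPollackRoy2006, Thm. 2.33] -/
theorem odd_countP_posRoots (P Q : ℝ[X]) (k : ℕ) (hPQ : P = X ^ k * Q) (hQ0 : Q.coeff 0 < 0) (hlead : 0 < Q.leadingCoeff) :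
    Odd (P.roots.countP (fun x => 0 < x)) := by
  classical
  have hQ : Q ≠ 0 := by rintro rfl; simp at hQ0
  have hXk : (X : ℝ[X]) ^ k ≠ 0 := pow_ne_zero _ X_ne_zero
  have hroots : P.roots.countP (fun x => 0 < x) = Q.roots.countP (fun x => 0 < x) := by
    rw [hPQ, roots_mul (mul_ne_zero hXk hQ), roots_X_pow, Multiset.countP_add]
    suffices h : Multiset.countP (fun x : ℝ => 0 < x) (k • ({0} : Multiset ℝ)) = 0 by rw [h, zero_add]
    rw [Multiset.countP_eq_zero]
    intro a ha
    rw [Multiset.mem_nsmul] at ha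
    rw [Multiset.mem_singleton.1 ha.2]
    exact lt_irrefl 0
  rw [hroots, ← Nat.not_even_iff_odd,
    Literature.Algebra.Polynomial.Descartes.even_countP_roots_pos_iff hQ0.ne, not_lt]
  exact (mul_neg_of_pos_of_neg hlead hQ0).le

/-- **THE PARITY BRIDGE.**  An odd count bounded by an even number is bounded by one less; with `card_posRoots_le_countP`: if the positive
roots of `P` counted with multiplicity are odd in number and at most `2j`, then `P` has at most `2j − 1` distinct positive roots. [folklore] -/
theorem card_posRoots_le_pred_of_odd (P : ℝ[X]) (j : ℕ) (hodd : Odd (P.roots.countP (fun x => 0 < x)))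
    (hle : P.roots.countP (fun x => 0 < x) ≤ 2 * j) :
    (P.roots.toFinset.filter (fun t => 0 < t)).card ≤ 2 * j - 1 := by
  have h := card_posRoots_le_countP P
  obtain ⟨i, hi⟩ := hodd
  omega

end Summit.ValiantsHypothesis.ValiantsHypothesis.Theorems.LacunarySymmetroidMatrixDescartes.Pivot.KillMult
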